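import Summits.QuantumFields.BalabanUV.Beta.FP.RoadEndGeneric
import Summits.QuantumFields.BalabanUV.Beta.FP.StepLawWard
import Summits.QuantumFields.BalabanUV.Beta.FP.StepLawInherit

/-!
# `BalabanUV.Beta.FP.StepLawWardGeneric` — road «FP» for binder row D1: THE STEP LAW AND THE ROAD's END IN GENERIC (FOUR-SLOT) SHAPE,
# with the transposition symmetry `hTsymm` and the Ward row `hWf` of the perfect one-step kernel, the EXPLICIT fixed-point defect against the
# UNDRESSED perfect transport column, and NO dressing named (owner ruling R-FP-13, part 2)

HONEST FRAMING (cell contract, verbatim): «discharging `BetaPertH` makes Bałaban's UV stability UNCONDITIONAL — a real constructive-QFT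
result; it is NOT the continuum limit and NOT the Clay problem.»  THIS MODULE DISCHARGES NOTHING: it is leaf-02-g4's `StepLawWard` §1–§2
(abstract: `secondMoment_succ_of_fubini_ward`, `wardDiag_of_ward_flip`) and leaf-01-g4's `StepLawInherit.absMoment₂_defect_explicit` instantiated at
the GENERIC perfect family of `RoadEndGeneric` (`TP m := TGenOf (Lc^m) (KPerfOf … A m) (KPerfOf … G m) (SPerfOf … m) (WPerfOf … m)` — any
resolvent families `A`, `G`, any stencil/table families, any units), with the transported first step read through the UNDRESSED perfect column
`colOf (KPerf Lc (sfStep Lc) (smStep 3 Lc) m)` whose Kronecker reproduction rows are tree theorems (`PerfectBubbleSandwich.entryHyps_perfCol_zero`,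
`PerfectColumnKronecker.linReproSum_perfCol_offDiag_holds` — K-side, UNCONDITIONAL).  RESULT: for EVERY wall family `Js` with a four-family closed
form (comb, block-mean rooted, or the DIRECT form), road FP's END reads
`D1Drift Lc Js N μ ν` ⟸ {closed form + `m = 1` names, Cauchy rows at `m = 1` (row G-an2-4 / stencil / table rows), class data of the perfect
objects (`m ≥ 1`), **`hWf`** (Ward row of the flipped perfect one-step kernel), **`hTsymm`** (its transposition symmetry), **`hSDF`** (β-additivity:
the explicit defect has zero `(μ,ν)` second moment), **`hasym`** (N7)} — the SAME residual shape as the comb END of record `RoadWardExplicit`, now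
literal-agnostic, so the letter suppliers (all typed for the block-mean rooted dressing — leaf-01-g5's census, journal l.15863) are consumed in the
dressing in which they exist.  Every analytic statement stays a HYPOTHESIS.  NOT «D1 closed», NOT BetaPertH, NOT continuum, NOT Clay.
ABSOLUTE RULE (cell, verbatim): «No internally-minted statement may enter as a cited fact. Every hypothesis is either kernel-proved in this
package or a verbatim quotation of a PUBLISHED theorem with page reference.»  Nothing cited; no `def … : Prop`; no binder instantiated at a value.
HONEST DEPENDENCY (verbatim): «continuum YM on T⁴ ⇐ BetaPertH ∧ nine spine estimates (0/9 proved); BetaPertH ⇐ (D1) ∧ (D4) ∧ CAP+tail;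
G-an2-4 gates asym, D1 and NE2/3/4.»

CONTENT.
* §1 `absMoment₂_TGenOf` — every entry of the four-slot kernel over decaying A- and K-slots, local stencils and bi-localised tables has absolutely
  summable second moments (`OneStepKernelFamily.absMoment₂_hessKer_of_decays` + `vertexFamily_vertexOfK'`).
* §2 **`fPerfG_succ_of_ward_symm_explicitDefect`** — `∀ m ≥ 1, fPerfG (m+1) = fPerfG m + fPerfG 1` ⟸ {class data of the perfect objects,
  `hWf`, `hTsymm`, `hSDF` (explicit defect)}; K-side column rows discharged.
* §3 **`d1Drift_of_generic_ward_symm_explicitDefect`** (any `Js` with a four-family closed form), **`d1Drift_dressBmAt_of_ward_symm_explicitDefect`**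
  (the block-mean rooted family `dressBmAt hr ∘ Js⁰`, an2's `TbalOf_dressBmAt`) — road FP's END, residual {rows, `hWf`, `hTsymm`, `hSDF`, `hasym`}.
Provenance: road FP owner b2b-balaban-beta-d1-p3 gen 3, 2026-08-20; over leaf-02-g4 `StepLawWard`, leaf-01-g4 `StepLawInherit`, leaf-02-g3
`PerfectBubbleSandwich`/`PerfectColumnKronecker`, asym1 `HessKerFourFamily`, an2 `AxialDressingRootedBmHessian`, owner `RoadEndGeneric` BY NAME.
[our object], 0 `def`, 0 cite, 0 sorry.
-/

namespace Summit.QuantumFields.BalabanUV.Beta.FP.StepLawWardGeneric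

open Filter Topology
open Literature.MathematicalPhysics.QuantumFieldTheory.Balaban1983to89
open Literature.MathematicalPhysics.QuantumFieldTheory.Balaban1983to89.Beta
open B12Beta (secondMoment)
open B12Normalization (stepBal)
open DecimatedMomentSummable (AbsMoment₂)
open DressedMomentNormalisation (EKer dressedEntry)
open ExpKernelCalculus (MKer Decays VertexFamily VertexFamily₂ hessKer)
open PolarizationSign (WardTransversal)
open OneStepResolventKernel (Fib LocStencil JetData biLoc_mono)
open OneStepKernelFamily (vertexOfK KInvStep TbalOf flipK D1Drift vertexFamily_vertexOfK' absMoment₂_hessKer_of_decays)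
open AffineAveraging (box toSite)
open HessKerDressedLimit (limMKerOf limStOf limTabOf)
open Summit.QuantumFields.BalabanUV.Beta.HessKerDressedUnits (unitK unitS unitW)
open Summit.QuantumFields.BalabanUV.Beta.AxialDressingRooted (dressBmAt coDressKBmAt TbalOf_dressBmAt)
open Summit.QuantumFields.BalabanUV.Beta.GAN24.CombesThomas (sfStep smStep)
open Summit.QuantumFields.BalabanUV.Beta.FP.PerfectObjectsT (KPerf SPerfOf WPerfOf)
open Summit.QuantumFields.BalabanUV.Beta.FP.TransportInfinityM (colOf)
open Summit.QuantumFields.BalabanUV.Beta.FP.StepDefectInherit (defect fubini_defect)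
open Summit.QuantumFields.BalabanUV.Beta.FP.StepLawWard (secondMoment_succ_of_fubini_ward wardDiag_of_ward_flip)
open Summit.QuantumFields.BalabanUV.Beta.FP.StepLawInherit (absMoment₂_defect_explicit)
open Summit.QuantumFields.BalabanUV.Beta.FP.PerfectBubbleSandwich (entryHyps_perfCol_zero)
open Summit.QuantumFields.BalabanUV.Beta.FP.PerfectColumnKronecker (linReproSum_perfCol_offDiag_holds)
open Summit.QuantumFields.BalabanUV.Beta.FP.RoadEndGeneric (KPerfOf TGenOf fPerfG fPerfG_def d1Drift_of_generic_step_law_bounded)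

noncomputable section

/-! ## §1 Well-typedness of the four-slot kernel -/

/-- [our object] **`AbsMoment₂` OF THE FOUR-SLOT KERNEL** (`1 ≤ n`): decaying A-slot and K-slot, local stencils, tables bi-localised at the coarse bonds
of blocking `n` ⇒ every entry of `TGenOf n A K S W` has absolutely summable second moments. -/
theorem absMoment₂_TGenOf {n : ℕ} (hn : 1 ≤ n) {A K : MKer (3 + 1) (Fib 3)}
    (hA : ∃ δ C : ℝ, 0 < δ ∧ 0 ≤ C ∧ Decays A C δ) (hK : ∃ δ C : ℝ, 0 < δ ∧ 0 ≤ C ∧ Decays K C δ)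
    {S : Fin (3 + 1) → (Fin (3 + 1) → ℤ) → MKer (3 + 1) (Fib 3)} {Cs δS : ℝ} (hS : LocStencil S Cs δS) (hδS : 0 < δS)
    {W : Fin (3 + 1) → (Fin (3 + 1) → ℤ) → Fin (3 + 1) → (Fin (3 + 1) → ℤ) → MKer (3 + 1) (Fib 3)} {Cw δW : ℝ}
    (hW : VertexFamily₂ W n Cw δW) (hδW : 0 < δW) (a b : Fin (3 + 1)) : AbsMoment₂ (TGenOf n A K S W a b) := by
  obtain ⟨Cv, δv, hδv, hV⟩ := vertexFamily_vertexOfK' (N := n) hK hS hδS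
  have hCv : 0 ≤ Cv := (hV a 0).nonneg (Sum.inl 0)
  have hCw : 0 ≤ Cw := (hW a 0 b 0).nonneg (Sum.inl 0)
  have hV' : VertexFamily (vertexOfK K n S) n Cv (min δv δW) := fun μ' y => biLoc_mono (hV μ' y) hCv (min_le_left _ _)
  have hW' : VertexFamily₂ W n Cw (min δv δW) := fun μ' y ν' y' => biLoc_mono (hW μ' y ν' y') hCw (min_le_right _ _)
  exact absMoment₂_hessKer_of_decays hA hV' hW' (lt_min hδv hδW) hn a b

/-! ## §2 The step law of the generic perfect coefficient family -/

section Step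

variable {Lc : ℕ} [NeZero Lc] (sf sm : ℕ → ℝ) (A G : ℕ → ℕ → MKer (3 + 1) (Fib 3))
  (S : ℕ → ℕ → Fin (3 + 1) → (Fin (3 + 1) → ℤ) → MKer (3 + 1) (Fib 3))
  (Wt : ℕ → ℕ → Fin (3 + 1) → (Fin (3 + 1) → ℤ) → Fin (3 + 1) → (Fin (3 + 1) → ℤ) → MKer (3 + 1) (Fib 3))

/-- **THE STEP LAW OF THE GENERIC PERFECT COEFFICIENT FAMILY** (`d = 3`, `2 ≤ Lc`; any resolvent families `A`, `G`, any stencils/tables, any units):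
`∀ m ≥ 1, fPerfG … (m+1) = fPerfG … m + fPerfG … 1` ⟸ {class data of the perfect objects at every `m ≥ 1` (decay of `KPerfOf … A m` / `KPerfOf … G m`,
localisation of `SPerfOf … m`, bi-localisation of `WPerfOf … m` at blocking `Lc^m`), the WARD ROW `hWf` of the flipped perfect one-step kernel, its
TRANSPOSITION SYMMETRY `hTsymm`, and `hSDF`: the EXPLICIT fixed-point defect `D m := TP (m+1) − RP m − TP m` (transport `RP` through the UNDRESSED
perfect column `colOf (KPerf Lc (sfStep Lc) (smStep 3 Lc) m)`, whose Kronecker reproduction rows are tree theorems) has zero `(μ,ν)` second moment}.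
leaf-02-g4's abstract `secondMoment_succ_of_fubini_ward`; (T0) and the diagonal (T1) from `hWf` (`wardDiag_of_ward_flip`). -/
theorem fPerfG_succ_of_ward_symm_explicitDefect (hLc : 2 ≤ Lc)
    (hAinf : ∀ m : ℕ, 1 ≤ m → ∃ δ C : ℝ, 0 < δ ∧ 0 ≤ C ∧ Decays (KPerfOf (d := 3) sf sm A m) C δ)
    (hGinf : ∀ m : ℕ, 1 ≤ m → ∃ δ C : ℝ, 0 < δ ∧ 0 ≤ C ∧ Decays (KPerfOf (d := 3) sf sm G m) C δ)
    (hSinf : ∀ m : ℕ, 1 ≤ m → ∃ Cs δS : ℝ, 0 < δS ∧ LocStencil (SPerfOf sf sm S m) Cs δS)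
    (hWinf : ∀ m : ℕ, 1 ≤ m → ∃ Cw δW : ℝ, 0 < δW ∧ VertexFamily₂ (WPerfOf sf sm Wt m) (Lc ^ m) Cw δW)
    (hWf : WardTransversal (flipK (TGenOf Lc (KPerfOf sf sm A 1) (KPerfOf sf sm G 1) (SPerfOf sf sm S 1) (WPerfOf sf sm Wt 1))))
    (hTsymm : ∀ a b t, TGenOf Lc (KPerfOf sf sm A 1) (KPerfOf sf sm G 1) (SPerfOf sf sm S 1) (WPerfOf sf sm Wt 1) a b t
      = TGenOf Lc (KPerfOf sf sm A 1) (KPerfOf sf sm G 1) (SPerfOf sf sm S 1) (WPerfOf sf sm Wt 1) b a (-t))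
    (μ ν : Fin 4)
    (hSDF : ∀ m : ℕ, 1 ≤ m → secondMoment (defect
      (fun m => TGenOf (Lc ^ m) (KPerfOf sf sm A m) (KPerfOf sf sm G m) (SPerfOf sf sm S m) (WPerfOf sf sm Wt m))
      (fun m a b z => ((Lc ^ m : ℕ) : ℝ) ^ 8 * dressedEntry (colOf (KPerf (d := 3) Lc (sfStep Lc) (smStep 3 Lc) m))
        (TGenOf Lc (KPerfOf sf sm A 1) (KPerfOf sf sm G 1) (SPerfOf sf sm S 1) (WPerfOf sf sm Wt 1))
        (((Lc ^ m : ℕ) : ℤ) • z) a b) m) μ ν = 0) :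
    ∀ m : ℕ, 1 ≤ m → fPerfG Lc sf sm A G S Wt μ ν (m + 1) = fPerfG Lc sf sm A G S Wt μ ν m + fPerfG Lc sf sm A G S Wt μ ν 1 := by
  set TP : ℕ → EKer 4 := fun m => TGenOf (Lc ^ m) (KPerfOf sf sm A m) (KPerfOf sf sm G m) (SPerfOf sf sm S m) (WPerfOf sf sm Wt m)
    with hTP
  have hTP1 : TP 1 = TGenOf Lc (KPerfOf sf sm A 1) (KPerfOf sf sm G 1) (SPerfOf sf sm S 1) (WPerfOf sf sm Wt 1) := by
    simp only [hTP, pow_one]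
  -- `AbsMoment₂` of every member from the class data
  have hA : ∀ m : ℕ, 1 ≤ m → ∀ a b, AbsMoment₂ (TP m a b) := fun m hm a b => by
    obtain ⟨Csm, δSm, hδSm, hSm⟩ := hSinf m hm
    obtain ⟨Cwm, δWm, hδWm, hWm⟩ := hWinf m hm
    exact absMoment₂_TGenOf (Nat.one_le_pow _ _ (by omega)) (hAinf m hm) (hGinf m hm) hSm hδSm hWm hδWm a b
  have hT : ∀ a b, AbsMoment₂ (TP 1 a b) := hA 1 le_rfl
  have hWf' : WardTransversal (flipK (TP 1)) := by rw [hTP1]; exact hWf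
  obtain ⟨hT0, hT1d⟩ := wardDiag_of_ward_flip hT hWf'
  have hTsymm' : ∀ a b t, TP 1 a b t = TP 1 b a (-t) := by rw [hTP1]; exact hTsymm
  -- the explicit defect: `hfub` definitional, `hDA` from `AbsMoment₂`
  have hDA := absMoment₂_defect_explicit (TP := TP) (w := fun m => colOf (KPerf (d := 3) Lc (sfStep Lc) (smStep 3 Lc) m))
    (N := fun m => Lc ^ m) (fun m _ => pow_ne_zero _ (NeZero.ne Lc)) (fun m hm => (entryHyps_perfCol_zero hLc hm).absW) hA
  have hfub : ∀ m : ℕ, 1 ≤ m → ∀ (a b : Fin 4) (z : Fin 4 → ℤ),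
      TP (m + 1) a b z = ((Lc ^ m : ℕ) : ℝ) ^ 8 * dressedEntry (colOf (KPerf (d := 3) Lc (sfStep Lc) (smStep 3 Lc) m)) (TP 1)
        (((Lc ^ m : ℕ) : ℤ) • z) a b + TP m a b z
        + defect TP (fun m a b z => ((Lc ^ m : ℕ) : ℝ) ^ 8 * dressedEntry (colOf (KPerf (d := 3) Lc (sfStep Lc) (smStep 3 Lc) m)) (TP 1)
            (((Lc ^ m : ℕ) : ℤ) • z) a b) m a b z :=
    fun m _ a b z => fubini_defect (TP := TP)
      (RP := fun m a b z => ((Lc ^ m : ℕ) : ℝ) ^ 8 * dressedEntry (colOf (KPerf (d := 3) Lc (sfStep Lc) (smStep 3 Lc) m)) (TP 1)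
        (((Lc ^ m : ℕ) : ℤ) • z) a b) m a b z
  have hSDF' : ∀ m : ℕ, 1 ≤ m → secondMoment (defect TP
      (fun m a b z => ((Lc ^ m : ℕ) : ℝ) ^ 8 * dressedEntry (colOf (KPerf (d := 3) Lc (sfStep Lc) (smStep 3 Lc) m)) (TP 1)
        (((Lc ^ m : ℕ) : ℤ) • z) a b) m) μ ν = 0 := by
    rw [hTP1]; exact hSDF
  have h := secondMoment_succ_of_fubini_ward (TP := TP) (w := fun m => colOf (KPerf (d := 3) Lc (sfStep Lc) (smStep 3 Lc) m))
    (N := fun m => Lc ^ m) hfub (fun m _ => Nat.pos_of_ne_zero (pow_ne_zero _ (NeZero.ne Lc)))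
    (fun m hm => (entryHyps_perfCol_zero hLc hm).const) (fun m hm => (entryHyps_perfCol_zero hLc hm).lin)
    (fun m hm κ l hκl => linReproSum_perfCol_offDiag_holds hLc hm hκl) (fun m hm => (entryHyps_perfCol_zero hLc hm).absW)
    hT hTsymm' hT0 hT1d hA hDA μ ν hSDF'
  intro m hm
  simpa only [fPerfG_def, TGenOf, hTP, pow_one] using h m hm

end Step

/-! ## §3 Road FP's END in generic shape: residual {rows, hWf, hTsymm, hSDF, hasym} -/

section End

variable {Lc : ℕ} [NeZero Lc] (Js : ℕ → JetData 3 Lc) (sf sm : ℕ → ℝ) (A G : ℕ → ℕ → MKer (3 + 1) (Fib 3))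
  (S : ℕ → ℕ → Fin (3 + 1) → (Fin (3 + 1) → ℤ) → MKer (3 + 1) (Fib 3))
  (Wt : ℕ → ℕ → Fin (3 + 1) → (Fin (3 + 1) → ℤ) → Fin (3 + 1) → (Fin (3 + 1) → ℤ) → MKer (3 + 1) (Fib 3))
  {A1 G1 : ℕ → MKer (3 + 1) (Fib 3)} {S1 : ℕ → Fin (3 + 1) → (Fin (3 + 1) → ℤ) → MKer (3 + 1) (Fib 3)}
  {W1 : ℕ → Fin (3 + 1) → (Fin (3 + 1) → ℤ) → Fin (3 + 1) → (Fin (3 + 1) → ℤ) → MKer (3 + 1) (Fib 3)}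
  {R CA cA C cK δK Cs cS δS Cw cW δW θ : ℝ}

/-- **ROAD «FP», THE END IN GENERIC SHAPE** (`d = 3`, `2 ≤ Lc`; bounded-defect form).  For ANY step jet data `Js` with a four-family closed form
`hT` and ANY (j, m)-families `(A, G, S, Wt)` with those `m = 1` members: `D1Drift Lc Js N μ ν` ⟸ EXACTLY {Cauchy-currency rows on the four
unit-rescaled `m = 1` families (row G-an2-4 / stencil / table rows), class data of the perfect objects (`m ≥ 1`), **`hWf`**, **`hTsymm`**, **`hSDF`**
(explicit defect), **`hasym`** (N7)} — `RoadEndGeneric.d1Drift_of_generic_step_law_bounded` with (STEP) := §2.  No dressing is named.  NOT «D1 closed». -/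
theorem d1Drift_of_generic_ward_symm_explicitDefect (hLc2 : 2 ≤ Lc) (hsf : ∀ j, sf j ≠ 0) (hsm : ∀ j, sm j ≠ 0)
    (hT : ∀ j, TbalOf Lc Js j = hessKer (A1 j) (vertexOfK (G1 j) Lc (S1 j)) (W1 j))
    (hA1 : ∀ j, A j 1 = A1 j) (hG1 : ∀ j, G j 1 = G1 j) (hS1 : ∀ j, S j 1 = S1 j) (hW1 : ∀ j, Wt j 1 = W1 j)
    (hA : ∀ j, Decays (unitK (sf j) (sm j) (A1 j)) CA δK)
    (hAall : ∀ k j, Decays (unitK (sf (k + j)) (sm (k + j)) (A1 (k + j)) - unitK (sf k) (sm k) (A1 k)) (cA * θ ^ k) δK)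
    (hK : ∀ j, Decays (unitK (sf j) (sm j) (G1 j)) C δK)
    (hKall : ∀ k j, Decays (unitK (sf (k + j)) (sm (k + j)) (G1 (k + j)) - unitK (sf k) (sm k) (G1 k)) (cK * θ ^ k) δK)
    (hS : ∀ j, LocStencil (unitS (sf j) (sm j) (S1 j)) Cs δS)
    (hSall : ∀ k j, LocStencil (unitS (sf (k + j)) (sm (k + j)) (S1 (k + j)) - unitS (sf k) (sm k) (S1 k)) (cS * θ ^ k) δS)
    (hW : ∀ j, VertexFamily₂ (unitW (sf j) (sm j) (W1 j)) Lc Cw δW)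
    (hWall : ∀ k j, VertexFamily₂ (unitW (sf (k + j)) (sm (k + j)) (W1 (k + j)) - unitW (sf k) (sm k) (W1 k)) Lc (cW * θ ^ k) δW)
    (hR : 0 < R) (hRK : R < δK) (hRS : R / 2 < δS) (hRW : R < δW) (hθ0 : 0 ≤ θ) (hθ1 : θ < 1)
    (hAinf : ∀ m : ℕ, 1 ≤ m → ∃ δ C : ℝ, 0 < δ ∧ 0 ≤ C ∧ Decays (KPerfOf (d := 3) sf sm A m) C δ)
    (hGinf : ∀ m : ℕ, 1 ≤ m → ∃ δ C : ℝ, 0 < δ ∧ 0 ≤ C ∧ Decays (KPerfOf (d := 3) sf sm G m) C δ)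
    (hSinf : ∀ m : ℕ, 1 ≤ m → ∃ Cs δS : ℝ, 0 < δS ∧ LocStencil (SPerfOf sf sm S m) Cs δS)
    (hWinf : ∀ m : ℕ, 1 ≤ m → ∃ Cw δW : ℝ, 0 < δW ∧ VertexFamily₂ (WPerfOf sf sm Wt m) (Lc ^ m) Cw δW)
    (hWf : WardTransversal (flipK (TGenOf Lc (KPerfOf sf sm A 1) (KPerfOf sf sm G 1) (SPerfOf sf sm S 1) (WPerfOf sf sm Wt 1))))
    (hTsymm : ∀ a b t, TGenOf Lc (KPerfOf sf sm A 1) (KPerfOf sf sm G 1) (SPerfOf sf sm S 1) (WPerfOf sf sm Wt 1) a b t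
      = TGenOf Lc (KPerfOf sf sm A 1) (KPerfOf sf sm G 1) (SPerfOf sf sm S 1) (WPerfOf sf sm Wt 1) b a (-t))
    (μ ν : Fin 4)
    (hSDF : ∀ m : ℕ, 1 ≤ m → secondMoment (defect
      (fun m => TGenOf (Lc ^ m) (KPerfOf sf sm A m) (KPerfOf sf sm G m) (SPerfOf sf sm S m) (WPerfOf sf sm Wt m))
      (fun m a b z => ((Lc ^ m : ℕ) : ℝ) ^ 8 * dressedEntry (colOf (KPerf (d := 3) Lc (sfStep Lc) (smStep 3 Lc) m))
        (TGenOf Lc (KPerfOf sf sm A 1) (KPerfOf sf sm G 1) (SPerfOf sf sm S 1) (WPerfOf sf sm Wt 1))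
        (((Lc ^ m : ℕ) : ℤ) • z) a b) m) μ ν = 0)
    {N Cg : ℝ} (hasym : ∀ m : ℕ, 1 ≤ m → |fPerfG Lc sf sm A G S Wt μ ν m - (m : ℝ) * stepBal N Lc| ≤ Cg) :
    D1Drift Lc Js N μ ν :=
  d1Drift_of_generic_step_law_bounded Js sf sm A G S Wt hsf hsm hT hA1 hG1 hS1 hW1 hA hAall hK hKall hS hSall hW hWall hR hRK hRS hRW
    hθ0 hθ1 μ ν (fPerfG_succ_of_ward_symm_explicitDefect sf sm A G S Wt hLc2 hAinf hGinf hSinf hWinf hWf hTsymm μ ν hSDF) hasym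

end End

section BlockMean

variable {Lc : ℕ} [NeZero Lc] {r : Fin 4 → ℕ} (hr : r ∈ box 4 Lc) (Js0 : ℕ → JetData 3 Lc) (sf sm : ℕ → ℝ)
  (G : ℕ → ℕ → MKer (3 + 1) (Fib 3)) (S : ℕ → ℕ → Fin (3 + 1) → (Fin (3 + 1) → ℤ) → MKer (3 + 1) (Fib 3))
  (Wt : ℕ → ℕ → Fin (3 + 1) → (Fin (3 + 1) → ℤ) → Fin (3 + 1) → (Fin (3 + 1) → ℤ) → MKer (3 + 1) (Fib 3))
  {R C cK δK Cs cS δS Cw cW δW θ : ℝ}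

/-- **ROAD «FP», THE END FOR A BLOCK-MEAN ROOTED DRESSED FAMILY, residual {rows, hWf, hTsymm, hSDF, hasym}** (`d = 3`, `2 ≤ Lc`, in-block root `r`):
`D1Drift Lc (dressBmAt hr ∘ Js⁰) N μ ν` for UNDRESSED step jets `Js⁰` and ANY (j, m)-families `(G, S, Wt)` with `m = 1` members
`(coDressKBmAt (toSite r) Lc (KInvStep Lc j), (Js⁰ j).S, (Js⁰ j).W)` — the dressing in which every finite-`j` Ward / relative-inverse letter of the tree
is typed; `hWf` is what those letters are to supply at the perfect triple (leaf-01-g5's «D1-FP-HH-INHERIT» mechanism over an1's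
`KernelWardRelative.wardTransversal_flipK_hessKer_conj_rel`). -/
theorem d1Drift_dressBmAt_of_ward_symm_explicitDefect (hLc2 : 2 ≤ Lc) (hsf : ∀ j, sf j ≠ 0) (hsm : ∀ j, sm j ≠ 0)
    (hG1 : ∀ j, G j 1 = coDressKBmAt (toSite r) Lc (KInvStep (d := 3) Lc j))
    (hS1 : ∀ j, S j 1 = (Js0 j).S) (hW1 : ∀ j, Wt j 1 = (Js0 j).W)
    (hK : ∀ j, Decays (unitK (sf j) (sm j) (coDressKBmAt (toSite r) Lc (KInvStep (d := 3) Lc j))) C δK)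
    (hKall : ∀ k j, Decays (unitK (sf (k + j)) (sm (k + j)) (coDressKBmAt (toSite r) Lc (KInvStep (d := 3) Lc (k + j))) -
      unitK (sf k) (sm k) (coDressKBmAt (toSite r) Lc (KInvStep (d := 3) Lc k))) (cK * θ ^ k) δK)
    (hS : ∀ j, LocStencil (unitS (sf j) (sm j) (Js0 j).S) Cs δS)
    (hSall : ∀ k j, LocStencil (unitS (sf (k + j)) (sm (k + j)) (Js0 (k + j)).S - unitS (sf k) (sm k) (Js0 k).S) (cS * θ ^ k) δS)
    (hW : ∀ j, VertexFamily₂ (unitW (sf j) (sm j) (Js0 j).W) Lc Cw δW)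
    (hWall : ∀ k j, VertexFamily₂ (unitW (sf (k + j)) (sm (k + j)) (Js0 (k + j)).W - unitW (sf k) (sm k) (Js0 k).W) Lc (cW * θ ^ k) δW)
    (hR : 0 < R) (hRK : R < δK) (hRS : R / 2 < δS) (hRW : R < δW) (hθ0 : 0 ≤ θ) (hθ1 : θ < 1)
    (hGinf : ∀ m : ℕ, 1 ≤ m → ∃ δ C : ℝ, 0 < δ ∧ 0 ≤ C ∧ Decays (KPerfOf (d := 3) sf sm G m) C δ)
    (hSinf : ∀ m : ℕ, 1 ≤ m → ∃ Cs δS : ℝ, 0 < δS ∧ LocStencil (SPerfOf sf sm S m) Cs δS)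
    (hWinf : ∀ m : ℕ, 1 ≤ m → ∃ Cw δW : ℝ, 0 < δW ∧ VertexFamily₂ (WPerfOf sf sm Wt m) (Lc ^ m) Cw δW)
    (hWf : WardTransversal (flipK (TGenOf Lc (KPerfOf sf sm G 1) (KPerfOf sf sm G 1) (SPerfOf sf sm S 1) (WPerfOf sf sm Wt 1))))
    (hTsymm : ∀ a b t, TGenOf Lc (KPerfOf sf sm G 1) (KPerfOf sf sm G 1) (SPerfOf sf sm S 1) (WPerfOf sf sm Wt 1) a b t
      = TGenOf Lc (KPerfOf sf sm G 1) (KPerfOf sf sm G 1) (SPerfOf sf sm S 1) (WPerfOf sf sm Wt 1) b a (-t))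
    (μ ν : Fin 4)
    (hSDF : ∀ m : ℕ, 1 ≤ m → secondMoment (defect
      (fun m => TGenOf (Lc ^ m) (KPerfOf sf sm G m) (KPerfOf sf sm G m) (SPerfOf sf sm S m) (WPerfOf sf sm Wt m))
      (fun m a b z => ((Lc ^ m : ℕ) : ℝ) ^ 8 * dressedEntry (colOf (KPerf (d := 3) Lc (sfStep Lc) (smStep 3 Lc) m))
        (TGenOf Lc (KPerfOf sf sm G 1) (KPerfOf sf sm G 1) (SPerfOf sf sm S 1) (WPerfOf sf sm Wt 1))
        (((Lc ^ m : ℕ) : ℤ) • z) a b) m) μ ν = 0)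
    {N Cg : ℝ} (hasym : ∀ m : ℕ, 1 ≤ m → |fPerfG Lc sf sm G G S Wt μ ν m - (m : ℝ) * stepBal N Lc| ≤ Cg) :
    D1Drift Lc (fun j => dressBmAt hr (Js0 j)) N μ ν :=
  d1Drift_of_generic_ward_symm_explicitDefect (fun j => dressBmAt hr (Js0 j)) sf sm G G S Wt
    (A1 := fun j => coDressKBmAt (toSite r) Lc (KInvStep (d := 3) Lc j)) (G1 := fun j => coDressKBmAt (toSite r) Lc (KInvStep (d := 3) Lc j))
    (S1 := fun j => (Js0 j).S) (W1 := fun j => (Js0 j).W) hLc2 hsf hsm (TbalOf_dressBmAt hr Js0) hG1 hG1 hS1 hW1 hK hKall hK hKall hS hSall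
    hW hWall hR hRK hRS hRW hθ0 hθ1 hGinf hGinf hSinf hWinf hWf hTsymm μ ν hSDF hasym

end BlockMean

end

end Summit.QuantumFields.BalabanUV.Beta.FP.StepLawWardGeneric
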